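import Summits.MatrixMultiplication.MatrixMultiplication.Theorems.SoloInformedLopsidedLadder
import Literature.Computability.AlgebraicComplexity.AsymptoticRankMatMul
import Literature.Computability.AlgebraicComplexity.LaserValue
import HarnessLib

/-!
# Symmetrization on the ladders: `R̃(⟨3,3,2⟩) = 9 ⟹ ω ≤ 3 log_18 9 < 2.281`, `R̃(⟨2,2,4⟩) = 8 ⟹ ω ≤ 9/4`

Solo-informed seat, gen 31 (s1, sixth file) — the CORRECT every-field value of a rung.  The
asymptotic form of "`R(⟨k,m,n⟩) ≤ r ⟹ ω ≤ 3 log_{kmn} r`" (Bläser 2013 Thm 5.9 / BCS Prop. 15.5, in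
the tree for the RANK as `Blaser2013Thm59_holds`) follows from the tree's asymptotic sum inequality in
asymptotic-rank form (`sum_rpow_omega_le_asymptoticRank`, one summand, via the tree's
`tensorRestrictsTo_matMulTensor_matMulDirectSum_single`):

* `soloInformed_rpow_omega_div_three_le_asymptoticRank_rect`: `(kmn)^{ω/3} ≤ R̃(⟨k,m,n⟩)`;
  `omega_le_three_mul_logb_of_asymptoticRank_matMulTensor_le`: `R̃(⟨k,m,n⟩) ≤ r ⟹ ω ≤ 3 log_{kmn} r` (`kmn > 1`).
* In exponent form `omega_mul_le_three_mul_omegaRect_nat`: `(a+b+c)·ω ≤ 3·ω(a,b,c)` (natural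
  `a,b,c`), `omega_mul_le_three_mul_omegaRect_one_one_nat`: `(k+2)·ω ≤ 3·ω(1,1,k)`.
* LEFT ladder: `omega_mul_le_six_of_lopsided_rung`: `R̃(⟨n,n,2⟩) ≤ n² ⟹ (2 + log_n 2)·ω ≤ 6`; rung 3:
  **`R̃(⟨3,3,2⟩) ≤ 9 ⟹ ω ≤ 3·log_18 9 (= 2.2806…) ≤ 2.281`** over every field
  (`omega_le_three_logb_of_asymptoticRank_332_le`, `omega_le_of_asymptoticRank_332_le_nine`) — this
  supersedes the blocking value `2.37` (`SoloInformedLadderLipschitz`) and the convexity value `2.3378`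
  (`SoloInformedLadderTransfer`): `6/(2+a) ≤ 3 − a` on `[0,1]`; rung 4: `ω ≤ 12/5` (no gain).
* RIGHT ladder: `omega_le_of_right_rung_nat`: `R̃(⟨n,n,n^k⟩) ≤ n^{k+1} ⟹ ω ≤ 3(k+1)/(k+2)`; the
  first right rung **`R̃(⟨2,2,4⟩) ≤ 8 ⟹ ω ≤ 9/4`** (`omega_le_of_asymptoticRank_224_le_eight`), every
  field — so `ρ_2` ALONE beats the laser record (correcting the reading of the convexity pinch in
  `SoloInformedLadderSqueeze`, whose `2.2702` from rung 3 ∧ ρ_2 is dominated by `9/4` from ρ_2 alone);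
  `ρ_3` gives only `12/5`.
So on BOTH ladders exactly the first rung beyond the CW barriers (left rung 3, right rung 2) is a
would-be record, by symmetrization alone.

[cite: Blaser2013, Theorem 5.9] [cite: BurgisserClausenShokrollahi1997, Prop. 15.5, Ex. 15.24(7)]
-/

set_option linter.dupNamespace false

namespace Summit.MatrixMultiplication.MatrixMultiplication.Theorems

open Literature.Computability.AlgebraicComplexity
open Literature.Barriers.MatrixMultiplication (asymptoticRank_le_of_polyDegeneratesTo)

variable (K : Type) [Field K]

/-- **`(kmn)^{ω/3} ≤ R̃(⟨k,m,n⟩)`** (asymptotic sum inequality with one rectangular summand).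
[cite: BurgisserClausenShokrollahi1997, Ex. 15.24(7)] -/
theorem soloInformed_rpow_omega_div_three_le_asymptoticRank_rect (k m n : ℕ) :
    ((k * m * n : ℕ) : ℝ) ^ (omega K / 3) ≤ asymptoticRank (matMulTensor K k m n) := by
  classical
  have h := sum_rpow_omega_le_asymptoticRank K (fun _ : Fin 1 => k) (fun _ => m) (fun _ => n)
  simp only [Finset.univ_unique, Finset.sum_singleton] at h
  exact h.trans (asymptoticRank_le_of_polyDegeneratesTo
    (tensorRestrictsTo_matMulTensor_matMulDirectSum_single K k m n).polyDegeneratesTo)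

/-- **Asymptotic Bläser 5.9: `R̃(⟨k,m,n⟩) ≤ r ⟹ ω ≤ 3 log_{kmn} r`** (`kmn > 1`).
[cite: Blaser2013, Theorem 5.9] -/
theorem omega_le_three_mul_logb_of_asymptoticRank_matMulTensor_le {k m n : ℕ} (h1 : 1 < k * m * n) {r : ℝ}
    (hr : asymptoticRank (matMulTensor K k m n) ≤ r) :
    omega K ≤ 3 * Real.logb (k * m * n : ℕ) r := by
  have hP : (1 : ℝ) < ((k * m * n : ℕ) : ℝ) := by exact_mod_cast h1
  have hP0 : (0 : ℝ) < ((k * m * n : ℕ) : ℝ) := by linarith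
  have h := (soloInformed_rpow_omega_div_three_le_asymptoticRank_rect K k m n).trans hr
  have hpos : 0 < ((k * m * n : ℕ) : ℝ) ^ (omega K / 3) := Real.rpow_pos_of_pos hP0 _
  have hlog := Real.logb_le_logb_of_le hP hpos h
  rw [Real.logb_rpow hP0 hP.ne'] at hlog
  linarith

/-- **`(a+b+c)·ω ≤ 3·ω(a,b,c)`** for natural `a, b, c` (symmetrization `⟨2^a,2^b,2^c⟩ ⊗ rotations =
⟨2^{a+b+c}, …⟩`, through `R̃(⟨2^a,2^b,2^c⟩) = 2^{ω(a,b,c)}`). [cite: Blaser2013, Theorem 5.9] -/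
theorem omega_mul_le_three_mul_omegaRect_nat (a b c : ℕ) :
    ((a + b + c : ℕ) : ℝ) * omega K ≤ 3 * omegaRect K a b c := by
  have h := soloInformed_rpow_omega_div_three_le_asymptoticRank_rect K (2 ^ a) (2 ^ b) (2 ^ c)
  rw [asymptoticRank_matMulTensor_rect K (le_refl 2) a b c] at h
  have e : (((2 ^ a * 2 ^ b * 2 ^ c : ℕ)) : ℝ) = (2 : ℝ) ^ ((a : ℝ) + b + c) := by
    rw [show ((a : ℝ) + b + c) = ((a + b + c : ℕ) : ℝ) by push_cast; ring, Real.rpow_natCast]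
    push_cast; ring
  rw [e, ← Real.rpow_mul (by norm_num : (0 : ℝ) ≤ 2)] at h
  simp only [Nat.cast_ofNat] at h
  rw [Real.rpow_le_rpow_left_iff (by norm_num : (1 : ℝ) < 2)] at h
  push_cast
  calc ((a : ℝ) + b + c) * omega K = 3 * (((a : ℝ) + b + c) * (omega K / 3)) := by ring
    _ ≤ 3 * omegaRect K a b c := mul_le_mul_of_nonneg_left h (by norm_num)

/-- **`(k+2)·ω ≤ 3·ω(1,1,k)`** for natural `k`. [cite: Blaser2013, Theorem 5.9] -/
theorem omega_mul_le_three_mul_omegaRect_one_one_nat (k : ℕ) :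
    ((k : ℝ) + 2) * omega K ≤ 3 * omegaRect K 1 1 k := by
  have h := omega_mul_le_three_mul_omegaRect_nat K 1 1 k
  push_cast at h
  calc ((k : ℝ) + 2) * omega K = (2 + (k : ℝ)) * omega K := by ring
    _ ≤ 3 * omegaRect K 1 1 k := h

/-! ## The left ladder -/

/-- **A lopsided rung bounds `ω` by symmetrization**: `R̃(⟨n,n,2⟩) ≤ n²` (`n ≥ 2`) ⟹
`(2 + log_n 2)·ω ≤ 6` (i.e. `ω ≤ 3 log_{2n²} n²`). [cite: Blaser2013, Theorem 5.9] -/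
theorem omega_mul_le_six_of_lopsided_rung {n : ℕ} (hn : 2 ≤ n)
    (h : asymptoticRank (matMulTensor K n n 2) ≤ (n : ℝ) ^ 2) :
    (2 + Real.logb n 2) * omega K ≤ 6 := by
  have hn1 : (1 : ℝ) < n := by exact_mod_cast hn
  have hn0 : (0 : ℝ) < n := by linarith
  have hω := (soloInformed_rpow_omega_div_three_le_asymptoticRank_rect K n n 2).trans h
  have hlogn : 0 < Real.log n := Real.log_pos hn1
  have hlog2 : 0 < Real.log 2 := Real.log_pos (by norm_num)
  have hP0 : (0 : ℝ) < ((n * n * 2 : ℕ) : ℝ) := by positivity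
  have hlog := Real.log_le_log (Real.rpow_pos_of_pos hP0 _) hω
  rw [Real.log_rpow hP0, Real.log_pow] at hlog
  push_cast at hlog
  rw [Real.log_mul (by positivity) (by norm_num), Real.log_mul hn0.ne' hn0.ne'] at hlog
  have key : omega K * (2 * Real.log n + Real.log 2) ≤ 6 * Real.log n := by
    have := hlog; ring_nf at this ⊢; linarith
  have e : (2 + Real.logb n 2) * omega K =
      omega K * (2 * Real.log n + Real.log 2) / Real.log n := by
    rw [Real.logb]; field_simp
  rw [e, div_le_iff₀ hlogn]
  linarith

/-- **`R̃(⟨3,3,2⟩) ≤ 9 ⟹ ω ≤ 3·log_18 9`** (`= 2.2805…`) over every field.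
[cite: Blaser2013, Theorem 5.9] -/
theorem omega_le_three_logb_of_asymptoticRank_332_le
    (h : asymptoticRank (matMulTensor K 3 3 2) ≤ 9) : omega K ≤ 3 * Real.logb 18 9 := by
  have := omega_le_three_mul_logb_of_asymptoticRank_matMulTensor_le K (by norm_num : 1 < 3 * 3 * 2) h
  norm_num at this
  exact this

set_option exponentiation.threshold 2500 in
/-- **`R̃(⟨3,3,2⟩) ≤ 9 ⟹ ω ≤ 2.281 < 2.371339` over EVERY field** (`18^ω ≤ 9³ = 729 < 18^{2.281}`,
as `729^{1000} < 18^{2281}`): rung 3 of the lopsided ladder would beat every known bound on `ω` by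
symmetrization alone. [cite: Blaser2013, Theorem 5.9] -/
theorem omega_le_of_asymptoticRank_332_le_nine (h : asymptoticRank (matMulTensor K 3 3 2) ≤ 9) :
    omega K ≤ 2.281 := by
  have hω := (soloInformed_rpow_omega_div_three_le_asymptoticRank_rect K 3 3 2).trans h
  norm_num at hω
  -- hω : 18 ^ (ω/3) ≤ 9; cube it
  have h3 : (18 : ℝ) ^ omega K ≤ 729 := by
    have e : (18 : ℝ) ^ omega K = ((18 : ℝ) ^ (omega K / 3)) ^ (3 : ℕ) := by
      rw [← Real.rpow_mul_natCast (by norm_num : (0 : ℝ) ≤ 18)]; ring_nf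
    rw [e]
    calc ((18 : ℝ) ^ (omega K / 3)) ^ (3 : ℕ) ≤ (9 : ℝ) ^ (3 : ℕ) :=
          pow_le_pow_left₀ (by positivity) hω 3
      _ = 729 := by norm_num
  by_contra hc
  push Not at hc
  have hlt : (18 : ℝ) ^ (2.281 : ℝ) < (18 : ℝ) ^ omega K :=
    Real.rpow_lt_rpow_of_exponent_lt (by norm_num) hc
  have hge : (729 : ℝ) < (18 : ℝ) ^ (2.281 : ℝ) := by
    have e : ((18 : ℝ) ^ (2.281 : ℝ)) ^ (1000 : ℕ) = (18 : ℝ) ^ (2281 : ℕ) := by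
      rw [← Real.rpow_mul_natCast (by norm_num : (0 : ℝ) ≤ 18)]
      norm_num
    have key : (729 : ℝ) ^ (1000 : ℕ) < ((18 : ℝ) ^ (2.281 : ℝ)) ^ (1000 : ℕ) := by
      rw [e]; norm_num
    exact lt_of_pow_lt_pow_left₀ 1000 (by positivity) key
  linarith

/-- For contrast, **rung 4 gives only `ω ≤ 12/5`** by symmetrization: `R̃(⟨4,4,2⟩) ≤ 16 = 32^{4/5}`.
[cite: Blaser2013, Theorem 5.9] -/
theorem omega_le_of_asymptoticRank_442_le_sixteen
    (h : asymptoticRank (matMulTensor K 4 4 2) ≤ 16) : omega K ≤ 12 / 5 := by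
  have hω := (soloInformed_rpow_omega_div_three_le_asymptoticRank_rect K 4 4 2).trans h
  norm_num at hω
  have e : (16 : ℝ) = (32 : ℝ) ^ ((4 : ℝ) / 5) := by
    rw [show (32 : ℝ) = 2 ^ (5 : ℝ) by norm_num, ← Real.rpow_mul (by norm_num)]
    norm_num
  rw [e, Real.rpow_le_rpow_left_iff (by norm_num : (1 : ℝ) < 32)] at hω
  linarith

/-! ## The right ladder -/

/-- **A right rung bounds `ω` by symmetrization**: `R̃(⟨n,n,n^k⟩) ≤ n^{k+1}` (`n ≥ 2`) ⟹
`ω ≤ 3(k+1)/(k+2)`. [cite: Blaser2013, Theorem 5.9] -/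
theorem omega_le_of_right_rung_nat {n : ℕ} (hn : 2 ≤ n) (k : ℕ)
    (h : asymptoticRank (matMulTensor K n n (n ^ k)) ≤ (n : ℝ) ^ (k + 1)) :
    omega K ≤ 3 * (k + 1) / (k + 2) := by
  have hn1 : (1 : ℝ) < n := by exact_mod_cast hn
  have hω := (soloInformed_rpow_omega_div_three_le_asymptoticRank_rect K n n (n ^ k)).trans h
  have e1 : (((n * n * n ^ k : ℕ)) : ℝ) = (n : ℝ) ^ (((k : ℝ) + 2)) := by
    rw [show ((k : ℝ) + 2) = ((k + 2 : ℕ) : ℝ) by push_cast; ring, Real.rpow_natCast]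
    push_cast; ring
  have e2 : ((n : ℝ) ^ (k + 1) : ℝ) = (n : ℝ) ^ (((k : ℝ) + 1)) := by
    rw [show ((k : ℝ) + 1) = ((k + 1 : ℕ) : ℝ) by push_cast; ring, Real.rpow_natCast]
  rw [e1, e2, ← Real.rpow_mul (by positivity), Real.rpow_le_rpow_left_iff hn1] at hω
  rw [le_div_iff₀ (by positivity)]
  nlinarith

/-- **The first right rung alone beats the laser record: `R̃(⟨2,2,4⟩) ≤ 8 ⟹ ω ≤ 9/4`** over every
field (`16^{ω/3} ≤ 8 = 16^{3/4}`). [cite: Blaser2013, Theorem 5.9] -/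
theorem omega_le_of_asymptoticRank_224_le_eight
    (h : asymptoticRank (matMulTensor K 2 2 4) ≤ 8) : omega K ≤ 9 / 4 := by
  have := omega_le_of_right_rung_nat K (le_refl 2) 2 (by norm_num; exact h)
  norm_num at this
  exact this

/-- `ω(1,1,2) = 3 ⟹ ω ≤ 9/4` (exponent form of the previous statement). [cite: Blaser2013, Theorem 5.9] -/
theorem omega_le_of_omegaRect_two_eq_three (h : omegaRect K 1 1 2 = 3) : omega K ≤ 9 / 4 := by
  have h2 := omega_mul_le_three_mul_omegaRect_one_one_nat K 2
  push_cast at h2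
  rw [h] at h2
  linarith

/-- For contrast, **the second right rung gives only `ω ≤ 12/5`**: `R̃(⟨2,2,8⟩) ≤ 16 ⟹ ω ≤ 12/5`.
[cite: Blaser2013, Theorem 5.9] -/
theorem omega_le_of_asymptoticRank_228_le_sixteen
    (h : asymptoticRank (matMulTensor K 2 2 8) ≤ 16) : omega K ≤ 12 / 5 := by
  have := omega_le_of_right_rung_nat K (le_refl 2) 3 (by norm_num; exact h)
  norm_num at this
  exact this

end Summit.MatrixMultiplication.MatrixMultiplication.Theorems
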